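import Literature.Analysis.ValidatedNumerics.TaylorModelIntegralCertArctanSharp
import HarnessLib

/-!
# Kernel-checkable integral certificates, generic in the statement family

Trunk T-ANA (Analysis/ValidatedNumerics); namespace `Literature.Analysis.ValidatedNumerics.PolyMP`.
`TaylorModelIntegralCertSLP.lean` / `…CertParam.lean` (statements `SOp`), `…CertTrig.lean` (`TOp` = `SOp` + `sin`,
`cos`), `…CertArctan.lean` (`AOp` = `TOp` + `atan`) and `…CertArctanSharp.lean` (the same `AOp` with a sharper
modeller) each RE-RUN the same program machinery of Melquiond (IJCAR 2008, Sect. 3.3: "the evaluator is generic in the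
operations" — a straight-line program is a list of statements over a stack, every statement pushes the value of one
operation on stack-relative operands) for one more statement type or one more modeller, by copy.  This file runs it
ONCE, over an abstract STATEMENT FAMILY, so that a further family (another intrinsic, or a sharper / wider modeller of
an existing one) is a twenty-line instance:

* `OpModel` — the COMPUTABLE half of a family: the statement type `Op`, a parameter record `Prm` (series orders,
  squaring counts …) and the statement modeller `model prm S h c Ws op cs : WExpr.MRes` (the Taylor model pushed on
  the panel `|u| ≤ h` centred at `c` given the register models `Ws`, consuming certificate candidates `cs`);
* `OpSem M` — its SEMANTIC half: the real function `evalF fs op` pushed by a statement given the register functions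
  `fs`, its measurability, and the one soundness obligation `tmem_model` (an accepted statement model encloses the
  pushed function under the stack invariant `StackMem`);
* generic over `M : OpModel` (computable, kernel- and `#eval`-reducible): the program modeller `M.pmodel`, the panel
  model `M.pmodelP` on the constant models of a parameter box, the certificate data `M.certData`, the one-shot
  certificate `M.certCheck` and the per-panel certificate `M.panelCheck`;
* generic over `F : OpSem M`: the denoted function `F.toFunP p ps` (run on the initial stack of constants), its
  measurability, **`F.stackMem_pmodel`**, **`F.tmem_pmodelP`**, **`F.integral_bounds_of_certCheck`**
  (`M.certCheck prm S h p B q css lo hi = true → BoxMem ps B → lo ≤ ∫₀^{2nh} F.toFunP p ps · q ≤ hi`) and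
  **`F.fsegOK_of_panelCheck`** (an `FSegOK` segment per panel, glued by `FSegOK.append` / `FSegOK.bounds` as before);
* the instances `OpModel.slp` / `OpSem.slp` (`SOp`), `.trig` (`TOp`), `.atan` (`AOp`), `.atanSharp` (`AOp` with
  `AOp.modelS`), with `toFunP_slp`, `toFunP_trig`, `toFunP_atan`, `toFunP_atanSharp` identifying the generic denoted
  function with `SProg.toFunP` / `TProg.toFunP` / `AProg.toFunP` (so the identification lemmas of existing
  certificates apply verbatim).

The split into a computable and a semantic record keeps `M.panelCheck …` evaluable by `decide` / the kernel and by
`#eval` (certificate generation), while `evalF` (real `sin`, `exp`, …) is noncomputable.  Problem-independent plumbing;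
no facts, no axioms.

## References

* G. Melquiond, *Proving bounds on real-valued functions with computations*, IJCAR 2008, LNCS 5195, 2–17: Sect. 3.3
  (straight-line programs; the generic evaluator over a stack, relative operand positions; the evaluator generic in
  the operations). [cite: Melquiond2008, Sect. 3.3]
* A. Mahboubi, G. Melquiond, T. Sibut-Pinote, *Formally verified approximations of definite integrals*, ITP 2016,
  LNCS 9807, 274–289: Sect. 3.2 Lemma 3, Sect. 3.3 (panel enclosures, their sum), Sect. 4.1 (programs on an initial
  stack of constants with interval hypotheses; inclusion theorem (3)). [cite: MahboubiMelquiondSibutpinote2016, Sect. 4.1]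
* M. Joldeş, *Rigorous Polynomial Approximations and Applications*, PhD thesis, ENS Lyon (2011): Algorithm 2.2.10
  (Taylor models of an expression by structural recursion). [cite: Joldes2011, Algorithm 2.2.10]
-/

open MeasureTheory intervalIntegral Set

namespace Literature.Analysis.ValidatedNumerics

namespace PolyMP

open Literature.Analysis.ValidatedNumerics.NumericsMP
open Literature.Analysis.ValidatedNumerics.ExpPoly (Poly BPoly)
open Literature.Analysis.ValidatedNumerics.ExpPoly

/-! ### Statement families -/

/-- **A statement family, computable half**: the statement type, the parameter record of the modeller, and the
statement modeller — the Taylor model pushed by one statement on the panel `|u| ≤ h` centred at `c`, given the stack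
`Ws` of register models, consuming certificate candidates (result record `WExpr.MRes`: model, unconsumed candidates,
acceptance flag). [cite: Melquiond2008, Sect. 3.3] -/
structure OpModel : Type 1 where
  /-- the statements -/
  Op : Type
  /-- the parameter record of the modeller (series orders, squaring counts, …) -/
  Prm : Type
  /-- the statement modeller -/
  model : Prm → ℕ → ℚ → ℚ → List IPoly → Op → List (List ℤ × ℕ) → WExpr.MRes

/-- A straight-line program over a statement family: its statements in execution order.
[cite: Melquiond2008, Sect. 3.3] -/
abbrev GProg (M : OpModel) : Type := List M.Op

/-- **A statement family, semantic half**: the real function pushed by one statement given the stack `fs` of the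
functions computed so far (default `0` past the bottom), its measurability, and the soundness of the statement
modeller under the stack invariant. [cite: Melquiond2008, Sect. 3.3] -/
structure OpSem (M : OpModel) : Type where
  /-- the real function pushed by a statement -/
  evalF : List (ℝ → ℝ) → M.Op → ℝ → ℝ
  /-- it is measurable when the registers are -/
  measurable_evalF : ∀ {fs : List (ℝ → ℝ)}, (∀ i, Measurable (getReg (fun _ => (0 : ℝ)) fs i)) →
    ∀ op : M.Op, Measurable (evalF fs op)
  /-- an accepted statement model encloses the pushed function, shifted to the panel centre -/
  tmem_model : ∀ (prm : M.Prm) {S : ℕ}, 0 < S → ∀ {h : ℚ}, 0 ≤ h → ∀ (c : ℚ) {fs : List (ℝ → ℝ)}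
    {Ws : List IPoly}, StackMem S h c fs Ws → ∀ (op : M.Op) (cs : List (List ℤ × ℕ)),
      (M.model prm S h c Ws op cs).ok = true → TMem S h (fun u => evalF fs op ((c : ℝ) + u)) (M.model prm S h c Ws op cs).P

/-! ### Semantics of programs -/

namespace OpSem

variable {M : OpModel} (F : OpSem M)

/-- Run a program on a stack of functions: each statement pushes its result. [cite: Melquiond2008, Sect. 3.3] -/
noncomputable def runF : GProg M → List (ℝ → ℝ) → List (ℝ → ℝ)
  | [], fs => fs
  | op :: p, fs => runF p (F.evalF fs op :: fs)

/-- **The real function denoted by a program with parameters**: the last result of its run on the initial stack of the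
constants `ps`. [cite: MahboubiMelquiondSibutpinote2016, Sect. 4.1] -/
noncomputable def toFunP (p : GProg M) (ps : List ℝ) : ℝ → ℝ :=
  getReg (fun _ => (0 : ℝ)) (F.runF p (constStack ps)) 0

/-- [folklore] -/
private theorem measurable_getReg_cons {f : ℝ → ℝ} {fs : List (ℝ → ℝ)} (hf : Measurable f)
    (hfs : ∀ i, Measurable (getReg (fun _ => (0 : ℝ)) fs i)) :
    ∀ i, Measurable (getReg (fun _ => (0 : ℝ)) (f :: fs) i)
  | 0 => by simpa using hf
  | i + 1 => by simpa using hfs i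

/-- [folklore] -/
private theorem measurable_runF : ∀ (p : GProg M) (fs : List (ℝ → ℝ)),
    (∀ i, Measurable (getReg (fun _ => (0 : ℝ)) fs i)) →
      ∀ i, Measurable (getReg (fun _ => (0 : ℝ)) (F.runF p fs) i)
  | [], fs, hfs => by simpa [runF] using hfs
  | op :: p, fs, hfs => by
      rw [runF]
      exact measurable_runF p _ (measurable_getReg_cons (F.measurable_evalF hfs op) hfs)

/-- [folklore] -/
private theorem measurable_constStack : ∀ (ps : List ℝ) (i : ℕ),
    Measurable (getReg (fun _ => (0 : ℝ)) (constStack ps) i)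
  | [], i => by rw [constStack, List.map_nil, getReg_nil]; exact measurable_const
  | c :: ps, 0 => by
      simp only [constStack, List.map_cons, getReg_cons_zero]
      exact measurable_const
  | c :: ps, i + 1 => by simpa [constStack] using measurable_constStack ps i

/-- The function denoted by a program with parameters is measurable (junk values included). [folklore] -/
private theorem measurable_toFunP (p : GProg M) (ps : List ℝ) : Measurable (F.toFunP p ps) := by
  unfold toFunP
  exact F.measurable_runF p (constStack ps) (measurable_constStack ps) 0

end OpSem

/-! ### The panel Taylor model of a program -/

/-- [folklore] -/
private theorem StackMem.consG {S : ℕ} {h : ℚ} {c : ℚ} {fs : List (ℝ → ℝ)} {Ws : List IPoly} (f : ℝ → ℝ)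
    {W : IPoly} (hf : TMem S h (fun u => f ((c : ℝ) + u)) W) (hst : StackMem S h c fs Ws) :
    StackMem S h c (f :: fs) (W :: Ws) := fun i => by
  cases i with
  | zero => simpa using hf
  | succ i => simpa using hst i

namespace OpModel

variable (M : OpModel)

/-- **The register models after running a program** on the panel centred at `c` from the stack `Ws`, with the
conjunctive acceptance flag (candidates consumed in program order). [cite: Melquiond2008, Sect. 3.3] -/
def pmodel (prm : M.Prm) (S : ℕ) (h : ℚ) (c : ℚ) : GProg M → List IPoly → List (List ℤ × ℕ) → List IPoly × Bool
  | [], Ws, _ => (Ws, true)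
  | op :: p, Ws, cs =>
      let r := M.model prm S h c Ws op cs
      let s := pmodel prm S h c p (r.P :: Ws) r.rest
      (s.1, r.ok && s.2)

/-- **The panel Taylor model of `u ↦ P(ps; c + u)`**: the top register model after the run on the initial stack of
constant models of the parameter box, with its acceptance flag. [cite: MahboubiMelquiondSibutpinote2016, Sect. 4.1] -/
def pmodelP (prm : M.Prm) (S : ℕ) (h : ℚ) (c : ℚ) (p : GProg M) (B : PBox) (cs : List (List ℤ × ℕ)) :
    IPoly × Bool :=
  let s := M.pmodel prm S h c p (constModels S B) cs
  (getReg [] s.1 0, s.2)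

/-- The panel data `(W_j, pw_j)` of panels `j₀, j₀+1, …` with its conjunctive acceptance flag; one candidate list per
panel. [folklore] -/
def certData (prm : M.Prm) (S : ℕ) (h : ℚ) (p : GProg M) (B : PBox) :
    List (List (List ℤ × ℕ)) → ℕ → List (IPoly × Poly) × Bool
  | [], _ => ([], true)
  | cs :: css, j =>
      let r := M.pmodelP prm S h (panelCentre h j) p B cs
      let t := certData prm S h p B css (j + 1)
      ((r.1, midPoly S r.1) :: t.1, r.2 && t.2)

/-- [folklore] -/
private theorem length_certData (prm : M.Prm) (S : ℕ) (h : ℚ) (p : GProg M) (B : PBox) :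
    ∀ (css : List (List (List ℤ × ℕ))) (j : ℕ), (M.certData prm S h p B css j).1.length = css.length
  | [], _ => rfl
  | _ :: css, j => by simp [certData, length_certData prm S h p B css (j + 1)]

/-- **The certificate** for `lo ≤ ∫₀^{2nh} P(ps; t) q(t) dt ≤ hi` (`n = css.length`), uniformly over the parameter box
`B`: positivity of `S` and `h`, every panel model accepted, and the kernel enclosure inside `[lo·S, hi·S]`. [folklore] -/
def certCheck (prm : M.Prm) (S : ℕ) (h : ℚ) (p : GProg M) (B : PBox) (q : Poly)
    (css : List (List (List ℤ × ℕ))) (lo hi : ℚ) : Bool :=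
  let d := M.certData prm S h p B css 0
  let I := fullPanelsI S h q d.1 0
  decide (0 < S) && decide (0 < h) && d.2 && decide (lo * S ≤ (I.lo : ℚ)) && decide ((I.hi : ℚ) ≤ hi * S)

/-- **The per-panel certificate**: positivity of `S` and `h`, the panel model accepted, and the kernel's panel
enclosure inside `[plo, phi]`. [folklore] -/
def panelCheck (prm : M.Prm) (S : ℕ) (h : ℚ) (p : GProg M) (B : PBox) (q : Poly) (j : ℕ)
    (cs : List (List ℤ × ℕ)) (plo phi : ℤ) : Bool :=
  let r := M.pmodelP prm S h (panelCentre h j) p B cs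
  let I := panelIntegI S h r.1 (midPoly S r.1) (recenter q h j)
  decide (0 < S) && decide (0 < h) && r.2 && decide (plo ≤ I.lo) && decide (I.hi ≤ phi)

end OpModel

/-! ### Soundness -/

namespace OpSem

variable {M : OpModel} (F : OpSem M)

/-- **Soundness of `OpModel.pmodel`**: the stack invariant is preserved by an accepted run.
[cite: Melquiond2008, Sect. 3.3] -/
theorem stackMem_pmodel (prm : M.Prm) {S : ℕ} (hS : 0 < S) {h : ℚ} (h0 : 0 ≤ h) (c : ℚ) :
    ∀ (p : GProg M) {fs : List (ℝ → ℝ)} {Ws : List IPoly}, StackMem S h c fs Ws →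
      ∀ cs : List (List ℤ × ℕ), (M.pmodel prm S h c p Ws cs).2 = true →
        StackMem S h c (F.runF p fs) (M.pmodel prm S h c p Ws cs).1
  | [], _, _, hst, cs, _ => by simpa [OpModel.pmodel, runF] using hst
  | op :: p, fs, Ws, hst, cs, hok => by
      simp only [OpModel.pmodel, Bool.and_eq_true] at hok
      rw [runF, OpModel.pmodel]
      exact stackMem_pmodel prm hS h0 c p (hst.consG (F.evalF fs op) (F.tmem_model prm hS h0 c hst op cs hok.1)) _ hok.2

/-- **Soundness of `OpModel.pmodelP`**: for every parameter vector of the box, an accepted model encloses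
`u ↦ P(ps; c + u)` on `|u| ≤ h`. [cite: MahboubiMelquiondSibutpinote2016, Sect. 4.1] -/
theorem tmem_pmodelP (prm : M.Prm) {S : ℕ} (hS : 0 < S) {h : ℚ} (h0 : 0 ≤ h) (c : ℚ) (p : GProg M)
    {ps : List ℝ} {B : PBox} (hB : BoxMem ps B) (cs : List (List ℤ × ℕ))
    (hok : (M.pmodelP prm S h c p B cs).2 = true) :
    TMem S h (fun u => F.toFunP p ps ((c : ℝ) + u)) (M.pmodelP prm S h c p B cs).1 := by
  unfold OpModel.pmodelP at hok ⊢
  unfold toFunP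
  exact F.stackMem_pmodel prm hS h0 c p (stackMem_const S h c hB) cs hok 0

/-- [folklore] -/
private theorem tmem_certData (prm : M.Prm) {S : ℕ} (hS : 0 < S) {h : ℚ} (h0 : 0 ≤ h) (p : GProg M)
    {ps : List ℝ} {B : PBox} (hB : BoxMem ps B) :
    ∀ (css : List (List (List ℤ × ℕ))) (j₀ : ℕ), (M.certData prm S h p B css j₀).2 = true →
      ∀ i : Fin (M.certData prm S h p B css j₀).1.length,
        TMem S h (fun u => F.toFunP p ps ((panelCentre h (j₀ + (i : ℕ)) : ℝ) + u))
          ((M.certData prm S h p B css j₀).1.get i).1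
  | [], _, _, i => i.elim0
  | cs :: css, j₀, hok, ⟨0, _⟩ => by
      simp only [OpModel.certData, Bool.and_eq_true] at hok
      simpa [OpModel.certData] using F.tmem_pmodelP prm hS h0 (panelCentre h j₀) p hB cs hok.1
  | cs :: css, j₀, hok, ⟨i + 1, hi⟩ => by
      simp only [OpModel.certData, Bool.and_eq_true] at hok
      have hi' : i < (M.certData prm S h p B css (j₀ + 1)).1.length := by
        simpa [OpModel.certData] using hi
      have ih := tmem_certData prm hS h0 p hB css (j₀ + 1) hok.2 ⟨i, hi'⟩
      have e : j₀ + 1 + i = j₀ + (i + 1) := by omega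
      simpa [OpModel.certData, e] using ih

/-- **Soundness of the certificate**: the piecewise polynomial integral enclosure re-computed by the kernel from
untrusted data bounds the integral for EVERY parameter vector of the box. [cite: MahboubiMelquiondSibutpinote2016, Sect. 4.1] -/
theorem integral_bounds_of_certCheck {prm : M.Prm} {S : ℕ} {h : ℚ} {p : GProg M} {B : PBox} {q : Poly}
    {css : List (List (List ℤ × ℕ))} {lo hi : ℚ}
    (hc : M.certCheck prm S h p B q css lo hi = true) {ps : List ℝ} (hB : BoxMem ps B) :
    (lo : ℝ) ≤ ∫ t in (0 : ℝ)..(2 * css.length * (h : ℝ)), F.toFunP p ps t * Poly.eval q t ∧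
      ∫ t in (0 : ℝ)..(2 * css.length * (h : ℝ)), F.toFunP p ps t * Poly.eval q t ≤ (hi : ℝ) := by
  unfold OpModel.certCheck at hc
  simp only [Bool.and_eq_true, decide_eq_true_eq] at hc
  obtain ⟨⟨⟨⟨hS, h0⟩, hok⟩, hlo⟩, hhi⟩ := hc
  have hD := F.tmem_certData prm hS h0.le p hB css 0 hok
  simp only [Nat.zero_add] at hD
  obtain ⟨hm, -⟩ := mem_fullPanelsI_of_tmem hS h0.le (F.measurable_toFunP p ps) q
    (M.certData prm S h p B css 0).1 0 (fun i => by simpa using hD i)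
  rw [OpModel.length_certData] at hm
  have e1 : (2 * ((0 : ℕ) : ℝ) * (h : ℝ)) = 0 := by simp
  have e2 : (2 * (((0 : ℕ) : ℝ) + (css.length : ℕ)) * (h : ℝ)) = 2 * css.length * (h : ℝ) := by simp
  rw [e1, e2] at hm
  obtain ⟨h1, h2⟩ := hm
  have hSr : (0 : ℝ) < S := by exact_mod_cast hS
  have hloR : (lo : ℝ) * S ≤ ((fullPanelsI S h q (M.certData prm S h p B css 0).1 0).lo : ℝ) := by
    exact_mod_cast hlo
  have hhiR : ((fullPanelsI S h q (M.certData prm S h p B css 0).1 0).hi : ℝ) ≤ (hi : ℝ) * S := by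
    exact_mod_cast hhi
  exact ⟨le_of_mul_le_mul_right (hloR.trans h1) hSr, le_of_mul_le_mul_right (h2.trans hhiR) hSr⟩

/-- **Soundness of the per-panel certificate**, for every parameter vector of the box: a certified function segment
`FSegOK (F.toFunP p ps) q S (2jh) (2(j+1)h) plo phi`, to be glued by `FSegOK.append` and read off by `FSegOK.bounds`.
[cite: MahboubiMelquiondSibutpinote2016, Sect. 3.2 Lemma 3, Sect. 4.1] -/
theorem fsegOK_of_panelCheck {prm : M.Prm} {S : ℕ} {h : ℚ} {p : GProg M} {B : PBox} {q : Poly} {j : ℕ}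
    {cs : List (List ℤ × ℕ)} {plo phi : ℤ} (hc : M.panelCheck prm S h p B q j cs plo phi = true)
    {ps : List ℝ} (hB : BoxMem ps B) :
    FSegOK (F.toFunP p ps) q S (panelLeft h j) (panelLeft h (j + 1)) plo phi := by
  unfold OpModel.panelCheck at hc
  simp only [Bool.and_eq_true, decide_eq_true_eq] at hc
  obtain ⟨⟨⟨⟨hS, h0⟩, hok⟩, hlo⟩, hhi⟩ := hc
  exact fsegOK_of_tmem hS h0 (F.measurable_toFunP p ps) q j (F.tmem_pmodelP prm hS h0.le (panelCentre h j) p hB cs hok)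
    hlo hhi

end OpSem

/-! ### Instances: the statement families already in the library -/

/-- [folklore] -/
private theorem measurable_evalF_S {fs : List (ℝ → ℝ)} (hfs : ∀ i, Measurable (getReg (fun _ => (0 : ℝ)) fs i)) :
    ∀ op : SOp, Measurable (op.evalF fs)
  | SOp.poly g => (Poly.continuous_eval g).measurable
  | SOp.expAff a b => by
      show Measurable fun t : ℝ => Real.exp ((a : ℝ) + b * t)
      exact Real.measurable_exp.comp (measurable_const.add (measurable_const.mul measurable_id))
  | SOp.neg i => (hfs i).neg
  | SOp.add i j => (hfs i).add (hfs j)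
  | SOp.mul i j => (hfs i).mul (hfs j)
  | SOp.inv i => (hfs i).inv
  | SOp.sqrt i => Real.continuous_sqrt.measurable.comp (hfs i)
  | SOp.log i => Real.measurable_log.comp (hfs i)
  | SOp.exp i => Real.measurable_exp.comp (hfs i)

/-- [folklore] -/
private theorem measurable_evalF_T {fs : List (ℝ → ℝ)} (hfs : ∀ i, Measurable (getReg (fun _ => (0 : ℝ)) fs i)) :
    ∀ op : TOp, Measurable (op.evalF fs)
  | TOp.base op => measurable_evalF_S hfs op
  | TOp.sin i => Real.measurable_sin.comp (hfs i)
  | TOp.cos i => Real.measurable_cos.comp (hfs i)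

/-- [folklore] -/
private theorem measurable_evalF_A {fs : List (ℝ → ℝ)} (hfs : ∀ i, Measurable (getReg (fun _ => (0 : ℝ)) fs i)) :
    ∀ op : AOp, Measurable (op.evalF fs)
  | AOp.base op => measurable_evalF_T hfs op
  | AOp.atan i => Real.continuous_arctan.measurable.comp (hfs i)

/-- Parameters of the `SOp` modeller (the expansion orders `n` of the Taylor-model algorithms of op. cit., one per
intrinsic, and the truncation degree): `D`, series terms `K` (`exp` compositions), `Ke`/`ke` (point values of `exp`),
`Kl` (`log`). [cite: Joldes2011, Algorithm 2.2.10] -/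
structure SlpPrm : Type where
  /-- truncation degree -/
  D : ℕ
  /-- series terms of the compositions -/
  K : ℕ
  /-- series terms of the `exp` point values -/
  Ke : ℕ
  /-- squarings of the `exp` point values -/
  ke : ℕ
  /-- `log` point-value parameter -/
  Kl : ℕ
  deriving Inhabited, Repr

/-- Parameters of the `TOp` modellers (expansion orders as in op. cit.): those of `SOp` and `Kt`/`kt` (terms and
halvings of the point values `e^{ic}`). [cite: Joldes2011, Algorithm 2.2.10] -/
structure TrigPrm : Type where
  /-- truncation degree -/
  D : ℕ
  /-- series terms of the compositions -/
  K : ℕ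
  /-- series terms of the `exp` point values -/
  Ke : ℕ
  /-- squarings of the `exp` point values -/
  ke : ℕ
  /-- `log` point-value parameter -/
  Kl : ℕ
  /-- series terms of the `e^{ic}` point values -/
  Kt : ℕ
  /-- halvings of the `e^{ic}` point values -/
  kt : ℕ
  deriving Inhabited, Repr

/-- Parameters of the `AOp` modellers (expansion orders as in op. cit.): those of `TOp` and `Ka` (the `arctan` point
values). [cite: Joldes2011, Algorithm 2.2.10] -/
structure AtanPrm : Type where
  /-- truncation degree -/
  D : ℕ
  /-- series terms of the compositions -/
  K : ℕ
  /-- series terms of the `exp` point values -/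
  Ke : ℕ
  /-- squarings of the `exp` point values -/
  ke : ℕ
  /-- `log` point-value parameter -/
  Kl : ℕ
  /-- series terms of the `e^{ic}` point values -/
  Kt : ℕ
  /-- halvings of the `e^{ic}` point values -/
  kt : ℕ
  /-- the `arctan` point-value parameter -/
  Ka : ℕ
  deriving Inhabited, Repr

/-- The family of `TaylorModelIntegralCertSLP.lean`: statements `SOp`, modeller `SOp.model`. [cite: Melquiond2008, Sect. 3.3] -/
abbrev OpModel.slp : OpModel :=
  ⟨SOp, SlpPrm, fun prm S h c Ws op cs => op.model S h prm.D prm.K prm.Ke prm.ke prm.Kl c Ws cs⟩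

/-- Its semantics `SOp.evalF` and soundness `SOp.tmem_model`. [cite: Melquiond2008, Sect. 3.3] -/
noncomputable def OpSem.slp : OpSem OpModel.slp where
  evalF := SOp.evalF
  measurable_evalF := fun hfs => measurable_evalF_S hfs
  tmem_model := fun _ _ hS _ h0 c _ _ hst op cs hok => SOp.tmem_model hS h0 c hst op cs hok

/-- The family of `TaylorModelIntegralCertTrig.lean`: statements `TOp`, modeller `TOp.model`. [cite: Melquiond2008, Sect. 3.3] -/
abbrev OpModel.trig : OpModel :=
  ⟨TOp, TrigPrm, fun prm S h c Ws op cs => op.model S h prm.D prm.K prm.Ke prm.ke prm.Kl prm.Kt prm.kt c Ws cs⟩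

/-- Its semantics `TOp.evalF` and soundness `TOp.tmem_model`. [cite: Melquiond2008, Sect. 3.3] -/
noncomputable def OpSem.trig : OpSem OpModel.trig where
  evalF := TOp.evalF
  measurable_evalF := fun hfs => measurable_evalF_T hfs
  tmem_model := fun _ _ hS _ h0 c _ _ hst op cs hok => TOp.tmem_model hS h0 c hst op cs hok

/-- The family of `TaylorModelIntegralCertArctan.lean`: statements `AOp`, modeller `AOp.model`. [cite: Melquiond2008, Sect. 3.3] -/
abbrev OpModel.atan : OpModel :=
  ⟨AOp, AtanPrm, fun prm S h c Ws op cs => op.model S h prm.D prm.K prm.Ke prm.ke prm.Kl prm.Kt prm.kt prm.Ka c Ws cs⟩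

/-- Its semantics `AOp.evalF` and soundness `AOp.tmem_model`. [cite: Melquiond2008, Sect. 3.3] -/
noncomputable def OpSem.atan : OpSem OpModel.atan where
  evalF := AOp.evalF
  measurable_evalF := fun hfs => measurable_evalF_A hfs
  tmem_model := fun _ _ hS _ h0 c _ _ hst op cs hok => AOp.tmem_model hS h0 c hst op cs hok

/-- The family of `TaylorModelIntegralCertArctanSharp.lean`: statements `AOp`, the sharp modeller `AOp.modelS`.
[cite: Melquiond2008, Sect. 3.3] -/
abbrev OpModel.atanSharp : OpModel :=
  ⟨AOp, AtanPrm, fun prm S h c Ws op cs => op.modelS S h prm.D prm.K prm.Ke prm.ke prm.Kl prm.Kt prm.kt prm.Ka c Ws cs⟩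

/-- Its semantics `AOp.evalF` (the same as `OpSem.atan`) and soundness `AOp.tmem_modelS`. [cite: Melquiond2008, Sect. 3.3] -/
noncomputable def OpSem.atanSharp : OpSem OpModel.atanSharp where
  evalF := AOp.evalF
  measurable_evalF := fun hfs => measurable_evalF_A hfs
  tmem_model := fun _ _ hS _ h0 c _ _ hst op cs hok => AOp.tmem_modelS hS h0 c hst op cs hok

/-- [folklore] -/
private theorem runF_slp : ∀ (p : SProg) (fs : List (ℝ → ℝ)), OpSem.slp.runF p fs = p.runF fs
  | [], _ => rfl
  | _ :: p, _ => runF_slp p _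

/-- [folklore] -/
private theorem runF_trig : ∀ (p : TProg) (fs : List (ℝ → ℝ)), OpSem.trig.runF p fs = p.runF fs
  | [], _ => rfl
  | _ :: p, _ => runF_trig p _

/-- [folklore] -/
private theorem runF_atan : ∀ (p : AProg) (fs : List (ℝ → ℝ)), OpSem.atan.runF p fs = p.runF fs
  | [], _ => rfl
  | _ :: p, _ => runF_atan p _

/-- [folklore] -/
private theorem runF_atanSharp : ∀ (p : AProg) (fs : List (ℝ → ℝ)), OpSem.atanSharp.runF p fs = p.runF fs
  | [], _ => rfl
  | _ :: p, _ => runF_atanSharp p _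

/-- The generic denoted function of an `SOp` program is `SProg.toFunP`. [cite: MahboubiMelquiondSibutpinote2016, Sect. 4.1] -/
@[simp] theorem toFunP_slp (p : SProg) (ps : List ℝ) : OpSem.slp.toFunP p ps = p.toFunP ps := by
  unfold OpSem.toFunP SProg.toFunP; rw [runF_slp]

/-- The generic denoted function of a `TOp` program is `TProg.toFunP`. [cite: MahboubiMelquiondSibutpinote2016, Sect. 4.1] -/
@[simp] theorem toFunP_trig (p : TProg) (ps : List ℝ) : OpSem.trig.toFunP p ps = p.toFunP ps := by
  unfold OpSem.toFunP TProg.toFunP; rw [runF_trig]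

/-- The generic denoted function of an `AOp` program is `AProg.toFunP`. [cite: MahboubiMelquiondSibutpinote2016, Sect. 4.1] -/
@[simp] theorem toFunP_atan (p : AProg) (ps : List ℝ) : OpSem.atan.toFunP p ps = p.toFunP ps := by
  unfold OpSem.toFunP AProg.toFunP; rw [runF_atan]

/-- The same for the sharp `arctan` family (same semantics). [cite: MahboubiMelquiondSibutpinote2016, Sect. 4.1] -/
@[simp] theorem toFunP_atanSharp (p : AProg) (ps : List ℝ) : OpSem.atanSharp.toFunP p ps = p.toFunP ps := by
  unfold OpSem.toFunP AProg.toFunP; rw [runF_atanSharp]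

end PolyMP

end Literature.Analysis.ValidatedNumerics
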